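import Summits.QuantumFields.BalabanUV.Beta.GAN24.DirichletVertexLocate

/-!
# `BalabanUV.Beta.GAN24.DirichletVertexLocalW` — binder row G-an2-4 / (CONV-C), road P2 PART IV, leaf L14 (the torus transfer), FILE C2τ′:
# THE UNWEIGHTED HESSIAN ON A TRANSLATED WINDOW UNDER THE WINDOW-RESTRICTED PRODUCT HYPOTHESIS, ON THE TORUS, `d = 2`
# (unit b2b-balaban-gan24-p2, gen 27, v1)

HONEST FRAMING (cell contract, verbatim): «discharging `BetaPertH` makes Bałaban's UV stability UNCONDITIONAL — a real constructive-QFT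
result; it is NOT the continuum limit and NOT the Clay problem.»  SUPPLIER module under the T⁴-DAG sub-row `T4-U1a.S-NE2-D1-DIRICHLET°`
(owner wording R24 «the full rate L⁻¹ beyond boxes OPEN»).  `DirichletVertexLocalT` (p245479) bounds the Hessian of the Dirichlet solution
on a translated window `emb σ b (Q_K + τ)` under the hypothesis `hAB` that the FULL star pattern of `b` is a product `A × B`.  LOCATED (gen 27):
a translated window (`τ ≠ 0`) sees at most two ADJACENT blocks of the star, whose sub-pattern is always a product, but the full star of `b`
may be re-entrant or checkerboard — then `hAB` fails although nothing in the proof needs it off the window.  THIS FILE re-proves the three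
window theorems of p245479 under the WINDOW-RESTRICTED hypothesis
`hW : ∀ (i, j) ∈ Q_K, emb σ b (i+τ₀) (j+τ₁) ∈ Ω ↔ WprodT A B τ₀ τ₁ i j` (proofs verbatim otherwise; the τ-range hypotheses disappear —
they only served to read `hAB` on the window), and supplies `hW` for the four window kinds of the census in the identity orientation:
corner window of a PRODUCT star, and the three translated kinds (one or both coordinates one-sided), for ANY block set `S`.

## Contents ([folklore]; 0 sorry)
* §1 `sqSum_indWT_le'`, **`vertexT_local_hessian_le'`**, **`vertexT_plain_hessian_le'`**, **`plainT_hessian_solExt_le'`** under `hW`.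
* §2 `sgnPat_eq_vec`; the window predicates `Awin`, `Bwin` of the census (read off `S` uniformly in the grid index `k`, identity
  orientation `TT` of `DirichletVertexLocate`), and **`hW_corner`** (k = (0,0), product star `IsProdAt`), **`hW_both`** (both coordinates
  one-sided), **`hW_fst`** / **`hW_snd`** (one coordinate two-sided).

ABSOLUTE RULE (cell, verbatim): «No internally-minted statement may enter as a cited fact. Every hypothesis is either kernel-proved in
this package or a verbatim quotation of a PUBLISHED theorem with page reference. The manuscript(s) under audit are NOT citable for
their own disputed steps — they are the thing under adjudication; programme-internal (2001/route/tribunal) claims are never citable.»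
Nothing printed is a hypothesis.  NOT CLAIMED: the coverage/domination, (A′) as a whole, (Φ)/(Φ′), the END (p234489 stays CONDITIONAL);
NOT NE2, (CONV-C), `BetaPertH`, continuum, Clay.  «not in print; our proof attempt».  HONEST DEPENDENCY: continuum YM on T⁴ ⇐ BetaPertH ∧
nine spine estimates (0/9 proved); BetaPertH ⇐ (D1) ∧ (D4) ∧ CAP+tail; G-an2-4 gates asym, D1 and NE2/3/4.
-/

noncomputable section

open scoped BigOperators ComplexConjugate Matrix
open Finset

namespace Summit.QuantumFields.BalabanUV.Beta.GAN24.DirichletVertexLocalW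

open Literature.MathematicalPhysics.QuantumFieldTheory.Balaban1983to89.B5Prop11Plancherel (Tor fine unitVec)
open Literature.MathematicalPhysics.QuantumFieldTheory.Balaban1983to89.B5Action121 (sdiff LapS)
open Literature.MathematicalPhysics.QuantumFieldTheory.Balaban1983to89.B5Prop11Lower (nsq nsq_nonneg)
open Summit.QuantumFields.BalabanUV.T4Continuum.ScalarAveragedPropagator (gammaPs gammaPs_pos dirichlet)
open Summit.QuantumFields.BalabanUV.Beta.GAN24.DirichletBoxRegularity (Pdir)
open Summit.QuantumFields.BalabanUV.Beta.GAN24.DirichletBoxTrace (blockReg)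
open Summit.QuantumFields.BalabanUV.Beta.GAN24.DirichletBoxCompression (solExt solExt_apply_of_not dirichlet_solExt_le
  sum_normSq_LapS_solExt_le nsq_solExt_le)
open DirichletRingEnergies (hb vb lap Et sqSum Et_nonneg sqSum_nonneg hb_nonneg vb_nonneg)
open DirichletRingCutoff (tIdx one_le_tIdx)
open DirichletRingHessianIdentity (d1 d2)
open DirichletRingHessianLocal (AxisSep indW indW_mem axisSep_prod)
open DirichletRingHessianLocalShift (local_hessian_le_shift)
open DirichletVertexChart
open DirichletVertexPullback
open DirichletVertexLocal (Wprod blockReg_emb_iff sgnPat_apply)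
open DirichletVertexLocalT
open DirichletVertexLocate (TT TT_apply crd_TT IsProdAt Arow Bcol pat_eq)

variable (n : ℕ) [NeZero n] (M : Fin 2 → ℕ) [hM : ∀ μ, NeZero (M μ)]

/-! ## §1 The window theorems under the window-restricted product hypothesis -/

section Window

variable {S : Tor M → Prop} {σ : Fin 2 → Bool} {b : Tor M} {A B : Bool → Prop} [DecidablePred A] [DecidablePred B]
  {u : Tor (fine n M) → ℂ} {τ₀ τ₁ : ℤ}

omit [NeZero n] hM in
/-- the range index `−K + s`, `s < 2K`, has half-index at most `K`. [folklore] -/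
theorem tIdx_range_le {K s : ℕ} (hs : s < 2 * K) : tIdx (-(K : ℤ) + s) ≤ K := by
  unfold tIdx; split_ifs <;> omega

/-- `𝟙_W`-weighted square-sum over the translated window of `‖F ∘ emb‖²` is a sub-sum of `Σ_{x∈Ω}‖F x‖²`, under `hW` on `Q_K`. [folklore] -/
theorem sqSum_indWT_le' [DecidablePred S] {K : ℕ}
    (hW : ∀ i j : ℤ, tIdx i ≤ K → tIdx j ≤ K → (blockReg n M S (emb n M σ b (i + τ₀) (j + τ₁)) ↔ WprodT A B τ₀ τ₁ i j))
    (F : Tor (fine n M) → ℂ) (h0 : 2 * K ≤ n * M 0) (h1 : 2 * K ≤ n * M 1) :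
    sqSum (fun i j => indW (WprodT A B τ₀ τ₁) i j * ‖F (emb n M σ b (i + τ₀) (j + τ₁))‖ ^ 2) K
      ≤ ∑ x ∈ univ.filter (blockReg n M S), ‖F x‖ ^ 2 := by
  set P : Tor (fine n M) → ℝ := fun x => if blockReg n M S x then ‖F x‖ ^ 2 else 0 with hP
  have hP0 : ∀ x, 0 ≤ P x := fun x => by rw [hP]; simp only; split_ifs <;> positivity
  have hterm : ∀ t ∈ range (2 * K), ∀ s ∈ range (2 * K),
      indW (WprodT A B τ₀ τ₁) (-(K : ℤ) + s) (-(K : ℤ) + t) * ‖F (emb n M σ b (-(K : ℤ) + s + τ₀) (-(K : ℤ) + t + τ₁))‖ ^ 2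
        ≤ P (emb n M σ b (-(K : ℤ) + s + τ₀) (-(K : ℤ) + t + τ₁)) := by
    intro t ht s hs
    simp only [mem_range] at ht hs
    rw [indW, hP]
    simp only
    have hiff := hW (-(K : ℤ) + s) (-(K : ℤ) + t) (tIdx_range_le hs) (tIdx_range_le ht)
    by_cases hw : WprodT A B τ₀ τ₁ (-(K : ℤ) + s) (-(K : ℤ) + t)
    · rw [if_pos hw, if_pos (hiff.mpr hw), one_mul]
    · rw [if_neg hw, zero_mul]; split_ifs <;> positivity
  calc sqSum (fun i j => indW (WprodT A B τ₀ τ₁) i j * ‖F (emb n M σ b (i + τ₀) (j + τ₁))‖ ^ 2) K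
      ≤ ∑ t ∈ range (2 * K), ∑ s ∈ range (2 * K), P (emb n M σ b (-(K : ℤ) + s + τ₀) (-(K : ℤ) + t + τ₁)) :=
        sum_le_sum fun t ht => sum_le_sum fun s hs => hterm t ht s hs
    _ ≤ ∑ x, P x := by
        refine sum_sum_le_univ_of_injOn n M (fun t s => emb n M σ b (-(K : ℤ) + s + τ₀) (-(K : ℤ) + t + τ₁)) P hP0 ?_
        intro t ht s hs t' ht' s' hs' h
        simp only [mem_range] at ht hs ht' hs'
        have := emb_injOn n M (σ := σ) (b := b) (a₀ := -(K : ℤ) + τ₀) (a₁ := -(K : ℤ) + τ₁) (W₀ := 2 * K) (W₁ := 2 * K) h0 h1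
          (i := -(K : ℤ) + s + τ₀) (j := -(K : ℤ) + t + τ₁) (i' := -(K : ℤ) + s' + τ₀) (j' := -(K : ℤ) + t' + τ₁)
          (by omega) (by omega) (by omega) (by omega) (by omega) (by omega) (by omega) (by omega) h
        omega
    _ = _ := by rw [hP, sum_filter]

/-- **THE LOCAL HESSIAN OF THE TRANSLATED PULL-BACK UNDER `hW`** (lattice units): for `u` vanishing off `Ω`, `1 ≤ L`, `K = 4L+c+1 ≤ n − 1`,
`2 ≤ M_ν`, and the window-restricted product hypothesis on `Q_K`:
`Σ_{Q_{2L+c−1}} 𝟙_W(|d1 UpT|²+|d2 UpT|²) ≤ 2·(Σ_{x∈Ω}|Δu|²)/n⁴ + (32/L²)(‖∂₀u‖²+‖∂₁u‖²)/n² + (16/L⁴)·nsq u`. [folklore] -/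
theorem vertexT_local_hessian_le' [DecidablePred S] (hu : ∀ x, ¬ blockReg n M S x → u x = 0) {L c : ℕ} (hL : 1 ≤ L)
    (hK : 4 * L + c + 2 ≤ n)
    (hW : ∀ i j : ℤ, tIdx i ≤ (4 * L + c + 1 : ℕ) → tIdx j ≤ (4 * L + c + 1 : ℕ) →
      (blockReg n M S (emb n M σ b (i + τ₀) (j + τ₁)) ↔ WprodT A B τ₀ τ₁ i j))
    (hM0 : 2 ≤ M 0) (hM1 : 2 ≤ M 1) :
    sqSum (fun i j => indW (WprodT A B τ₀ τ₁) i j * (‖d1 (UpT n M σ b u τ₀ τ₁) i j‖ ^ 2 + ‖d2 (UpT n M σ b u τ₀ τ₁) i j‖ ^ 2))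
        (2 * L + c - 1)
      ≤ 2 * ((∑ x ∈ univ.filter (blockReg n M S), ‖(LapS (fine n M) (n : ℂ) *ᵥ u) x‖ ^ 2) / (n : ℝ) ^ 4)
        + 32 / (L : ℝ) ^ 2 * ((nsq (sdiff (fine n M) (n : ℂ) 0 *ᵥ u) + nsq (sdiff (fine n M) (n : ℂ) 1 *ᵥ u)) / (n : ℝ) ^ 2)
        + 16 / (L : ℝ) ^ 4 * nsq u := by
  set K : ℕ := 4 * L + c + 1 with hKdef
  have hKn : K + 1 ≤ n := by omega
  have hn0 : (0 : ℝ) < n := by exact_mod_cast Nat.pos_of_ne_zero (NeZero.ne n)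
  have hW0 : 2 * K + 2 ≤ n * M 0 := by have := Nat.mul_le_mul_left n hM0; omega
  have hW1 : 2 * K + 2 ≤ n * M 1 := by have := Nat.mul_le_mul_left n hM1; omega
  set U : ℤ → ℤ → ℂ := UpT n M σ b u τ₀ τ₁ with hU
  set G : ℤ → ℤ → ℂ := fun i j => (LapS (fine n M) (n : ℂ) *ᵥ u) (emb n M σ b (i + τ₀) (j + τ₁)) / (n : ℂ) ^ 2 with hG
  have hUW : ∀ i j : ℤ, tIdx i ≤ 4 * (L : ℤ) + c → tIdx j ≤ 4 * (L : ℤ) + c → ¬ WprodT A B τ₀ τ₁ i j → U i j = 0 := by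
    intro i j hi hj hw
    have hKc : ((4 * L + c + 1 : ℕ) : ℤ) = 4 * (L : ℤ) + c + 1 := by push_cast; ring
    exact hu _ (fun h => hw ((hW i j (by rw [hKc]; omega) (by rw [hKc]; omega)).mp h))
  have hEq : ∀ i j : ℤ, tIdx i ≤ 4 * (L : ℤ) + c + 1 → tIdx j ≤ 4 * (L : ℤ) + c + 1 → WprodT A B τ₀ τ₁ i j → lap U i j = G i j := by
    intro i j _ _ _
    have hn2 : (n : ℂ) ^ 2 ≠ 0 := pow_ne_zero 2 (by exact_mod_cast NeZero.ne n)
    show lap U i j = (LapS (fine n M) (n : ℂ) *ᵥ u) (emb n M σ b (i + τ₀) (j + τ₁)) / (n : ℂ) ^ 2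
    rw [hU, lap_UpT, LapS_emb, mul_div_cancel_left₀ _ hn2]
  have hloc := local_hessian_le_shift (WprodT A B τ₀ τ₁) U hL (axisSep_WprodT A B τ₀ τ₁) G hUW hEq
  have hSG : sqSum (fun i j => indW (WprodT A B τ₀ τ₁) i j * ‖G i j‖ ^ 2) K
      ≤ (∑ x ∈ univ.filter (blockReg n M S), ‖(LapS (fine n M) (n : ℂ) *ᵥ u) x‖ ^ 2) / (n : ℝ) ^ 4 := by
    have h : sqSum (fun i j => indW (WprodT A B τ₀ τ₁) i j
          * ‖(LapS (fine n M) (n : ℂ) *ᵥ u) (emb n M σ b (i + τ₀) (j + τ₁)) / (n : ℂ) ^ 2‖ ^ 2) K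
        ≤ ∑ x ∈ univ.filter (blockReg n M S), ‖(LapS (fine n M) (n : ℂ) *ᵥ u) x / (n : ℂ) ^ 2‖ ^ 2 :=
      sqSum_indWT_le' n M hW (fun x => (LapS (fine n M) (n : ℂ) *ᵥ u) x / (n : ℂ) ^ 2) (by omega) (by omega)
    have e : ∀ x, ‖(LapS (fine n M) (n : ℂ) *ᵥ u) x / (n : ℂ) ^ 2‖ ^ 2 = ‖(LapS (fine n M) (n : ℂ) *ᵥ u) x‖ ^ 2 / (n : ℝ) ^ 4 := by
      intro x; rw [norm_div, div_pow, norm_pow, Complex.norm_natCast, ← pow_mul]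
    have e2 : (fun i j => indW (WprodT A B τ₀ τ₁) i j * ‖G i j‖ ^ 2)
        = (fun i j => indW (WprodT A B τ₀ τ₁) i j * (‖(LapS (fine n M) (n : ℂ) *ᵥ u) (emb n M σ b (i + τ₀) (j + τ₁))‖ ^ 2 / (n : ℝ) ^ 4)) := by
      funext i j; simp only [hG, e]
    simp only [e] at h
    rw [e2, Finset.sum_div]
    exact h
  have hEt : Et U K ≤ (nsq (sdiff (fine n M) (n : ℂ) 0 *ᵥ u) + nsq (sdiff (fine n M) (n : ℂ) 1 *ᵥ u)) / (n : ℝ) ^ 2 := by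
    rw [Et_eq_rect, add_div]
    exact add_le_add (EtH_UpT_le n M u hW0 (by omega)) (EtV_UpT_le n M u (by omega) hW1)
  have hS : sqSum (fun i j => ‖U i j‖ ^ 2) K ≤ nsq u := sqSum_normSq_UpT_le n M u (by omega) (by omega)
  refine hloc.trans ?_
  gcongr

/-- **THE UNWEIGHTED HESSIAN CHARGED TO A TRANSLATED WINDOW UNDER `hW`**: for `u` vanishing off `Ω`, `1 ≤ L`, `4L + c + 2 ≤ n`, `2 ≤ M_ν`,
plateau `P = 2L + c − 1`:
`Σ_μ Σ_x plainWT(x)·|(∂ᴴ_μ∂_μ u)(x)|² ≤ 2·Σ_{x∈Ω}|Δu|² + 32(n/L)²(‖∂₀u‖²+‖∂₁u‖²) + 16(n/L)⁴·nsq u`. [folklore] -/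
theorem vertexT_plain_hessian_le' [DecidablePred S] (hu : ∀ x, ¬ blockReg n M S x → u x = 0) {L c : ℕ} (hL : 1 ≤ L)
    (hK : 4 * L + c + 2 ≤ n)
    (hW : ∀ i j : ℤ, tIdx i ≤ (4 * L + c + 1 : ℕ) → tIdx j ≤ (4 * L + c + 1 : ℕ) →
      (blockReg n M S (emb n M σ b (i + τ₀) (j + τ₁)) ↔ WprodT A B τ₀ τ₁ i j))
    (hM0 : 2 ≤ M 0) (hM1 : 2 ≤ M 1) :
    ∑ μ, ∑ x, plainWT n M (σ, b) A B τ₀ τ₁ (2 * L + c - 1) x * ‖(Pdir (fine n M) (n : ℂ) μ *ᵥ u) x‖ ^ 2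
      ≤ 2 * ∑ x ∈ univ.filter (blockReg n M S), ‖(LapS (fine n M) (n : ℂ) *ᵥ u) x‖ ^ 2
        + 32 * ((n : ℝ) / L) ^ 2 * (nsq (sdiff (fine n M) (n : ℂ) 0 *ᵥ u) + nsq (sdiff (fine n M) (n : ℂ) 1 *ᵥ u))
        + 16 * ((n : ℝ) / L) ^ 4 * nsq u := by
  set P : ℕ := 2 * L + c - 1 with hP
  have hn0 : (0 : ℝ) < n := by exact_mod_cast Nat.pos_of_ne_zero (NeZero.ne n)
  have hL0 : (0 : ℝ) < L := by exact_mod_cast hL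
  have hloc := vertexT_local_hessian_le' n M hu hL hK hW hM0 hM1
  have step1 : ∑ μ, ∑ x, plainWT n M (σ, b) A B τ₀ τ₁ P x * ‖(Pdir (fine n M) (n : ℂ) μ *ᵥ u) x‖ ^ 2
      = (n : ℝ) ^ 4 * sqSum (fun i j => indW (WprodT A B τ₀ τ₁) i j
          * (‖d1 (UpT n M σ b u τ₀ τ₁) i j‖ ^ 2 + ‖d2 (UpT n M σ b u τ₀ τ₁) i j‖ ^ 2)) P := by
    rw [Fin.sum_univ_two, sum_plainWT_mul, sum_plainWT_mul, ← sum_add_distrib, sqSum, mul_sum]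
    refine sum_congr rfl fun t _ => ?_
    rw [← sum_add_distrib, mul_sum]
    refine sum_congr rfl fun s _ => ?_
    rw [Pdir_embT_fst, Pdir_embT_snd, norm_mul, norm_mul, norm_neg, norm_pow, Complex.norm_natCast, mul_pow, mul_pow, ← pow_mul]
    ring
  rw [step1]
  have e : (n : ℝ) ^ 4 * (2 * ((∑ x ∈ univ.filter (blockReg n M S), ‖(LapS (fine n M) (n : ℂ) *ᵥ u) x‖ ^ 2) / (n : ℝ) ^ 4)
        + 32 / (L : ℝ) ^ 2 * ((nsq (sdiff (fine n M) (n : ℂ) 0 *ᵥ u) + nsq (sdiff (fine n M) (n : ℂ) 1 *ᵥ u)) / (n : ℝ) ^ 2)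
        + 16 / (L : ℝ) ^ 4 * nsq u)
      = 2 * ∑ x ∈ univ.filter (blockReg n M S), ‖(LapS (fine n M) (n : ℂ) *ᵥ u) x‖ ^ 2
        + 32 * ((n : ℝ) / L) ^ 2 * (nsq (sdiff (fine n M) (n : ℂ) 0 *ᵥ u) + nsq (sdiff (fine n M) (n : ℂ) 1 *ᵥ u))
        + 16 * ((n : ℝ) / L) ^ 4 * nsq u := by
    field_simp
  rw [← e]
  exact mul_le_mul_of_nonneg_left hloc (by positivity)

variable (S) (a' : ℝ)

/-- **THE UNWEIGHTED HESSIAN OF THE DIRICHLET SOLUTION CHARGED TO A TRANSLATED WINDOW UNDER `hW`**: for `u = solExt n M a′ Ω f`,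
`Σ_μ Σ_x plainWT(x)·|(∂ᴴ_μ∂_μ u)(x)|² ≤ (4(1+(a′γ′⁻¹)²) + 32(n/L)²γ′⁻¹ + 16(n/L)⁴γ′⁻²)·‖f‖²`. [folklore] -/
theorem plainT_hessian_solExt_le' [DecidablePred S] {L c : ℕ} (hL : 1 ≤ L) (hK : 4 * L + c + 2 ≤ n)
    (hW : ∀ i j : ℤ, tIdx i ≤ (4 * L + c + 1 : ℕ) → tIdx j ≤ (4 * L + c + 1 : ℕ) →
      (blockReg n M S (emb n M σ b (i + τ₀) (j + τ₁)) ↔ WprodT A B τ₀ τ₁ i j))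
    (hM0 : 2 ≤ M 0) (hM1 : 2 ≤ M 1) (ha' : 0 < a') (f : {y // blockReg n M S y} → ℂ) :
    ∑ μ, ∑ x, plainWT n M (σ, b) A B τ₀ τ₁ (2 * L + c - 1) x
        * ‖(Pdir (fine n M) (n : ℂ) μ *ᵥ solExt n M a' (blockReg n M S) f) x‖ ^ 2
      ≤ (4 * (1 + (a' * (gammaPs 2 a')⁻¹) ^ 2) + 32 * ((n : ℝ) / L) ^ 2 * (gammaPs 2 a')⁻¹
          + 16 * ((n : ℝ) / L) ^ 4 * ((gammaPs 2 a')⁻¹) ^ 2) * nsq f := by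
  set u := solExt n M a' (blockReg n M S) f with hu
  have hu0 : ∀ x, ¬ blockReg n M S x → u x = 0 := fun x hx => solExt_apply_of_not n M a' _ f hx
  have hγp := (gammaPs_pos (d := 2) (a' := a')).1
  have hE : nsq (sdiff (fine n M) (n : ℂ) 0 *ᵥ u) + nsq (sdiff (fine n M) (n : ℂ) 1 *ᵥ u) ≤ (gammaPs 2 a')⁻¹ * nsq f := by
    have h := dirichlet_solExt_le n M a' (blockReg n M S) ha' f
    rw [dirichlet, Fin.sum_univ_two] at h
    exact h
  have hB : ∑ x ∈ univ.filter (blockReg n M S), ‖(LapS (fine n M) (n : ℂ) *ᵥ u) x‖ ^ 2 ≤ 2 * (1 + (a' * (gammaPs 2 a')⁻¹) ^ 2) * nsq f := by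
    rw [Finset.sum_subtype (univ.filter (blockReg n M S)) (p := blockReg n M S) (fun x => by simp)
      (fun x => ‖(LapS (fine n M) (n : ℂ) *ᵥ u) x‖ ^ 2)]
    exact sum_normSq_LapS_solExt_le n M a' (blockReg n M S) ha' f
  have hN : nsq u ≤ ((gammaPs 2 a')⁻¹) ^ 2 * nsq f := nsq_solExt_le n M a' (blockReg n M S) ha' f
  have hf0 := nsq_nonneg f
  have h := vertexT_plain_hessian_le' n M (σ := σ) (b := b) (A := A) (B := B) hu0 hL hK hW hM0 hM1
  refine h.trans ?_
  have hn0 : (0 : ℝ) ≤ ((n : ℝ) / L) ^ 2 := sq_nonneg _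
  have hn4 : (0 : ℝ) ≤ ((n : ℝ) / L) ^ 4 := by positivity
  nlinarith [mul_le_mul_of_nonneg_left hE (by positivity : (0 : ℝ) ≤ 32 * ((n : ℝ) / L) ^ 2),
    mul_le_mul_of_nonneg_left hN (by positivity : (0 : ℝ) ≤ 16 * ((n : ℝ) / L) ^ 4)]

end Window

/-! ## §2 The window predicates of the census and their `hW` -/

section Census

variable {S : Tor M → Prop}

omit hM in
/-- the sign pattern of a model site as a two-vector. [folklore] -/
theorem sgnPat_eq_vec (i j : ℤ) : sgnPat i j = ![decide (0 ≤ i), decide (0 ≤ j)] := by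
  funext ν; fin_cases ν <;> simp [sgnPat, cvec]

/-- the FIRST-AXIS WINDOW PREDICATE of the census window with grid index `(k₀, k₁)` at the base vertex `b` (identity orientation):
corner (`k = 0`): the first projection of the star pattern; `k₀ = 0 < k₁`: the row pattern `s ↦ (s, T) ∈ P`; `k₀ > 0 = k₁`: trivial;
both `> 0`: the constant `(T, T) ∈ P`. [folklore] -/
def Awin (S : Tor M → Prop) (b : Tor M) (k₀ k₁ : ℕ) (s : Bool) : Prop :=
  (k₀ = 0 ∧ k₁ = 0 ∧ (S (starBlk M TT b ![s, true]) ∨ S (starBlk M TT b ![s, false])))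
    ∨ (k₀ = 0 ∧ k₁ ≠ 0 ∧ S (starBlk M TT b ![s, true]))
    ∨ (k₀ ≠ 0 ∧ k₁ = 0)
    ∨ (k₀ ≠ 0 ∧ k₁ ≠ 0 ∧ S (starBlk M TT b ![true, true]))

/-- the SECOND-AXIS WINDOW PREDICATE: corner: the second projection; `k₀ > 0 = k₁`: the column pattern `t ↦ (T, t) ∈ P`; else trivial.
[folklore] -/
def Bwin (S : Tor M → Prop) (b : Tor M) (k₀ k₁ : ℕ) (t : Bool) : Prop :=
  (k₀ = 0 ∧ k₁ = 0 ∧ (S (starBlk M TT b ![true, t]) ∨ S (starBlk M TT b ![false, t])))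
    ∨ (k₀ ≠ 0 ∧ k₁ = 0 ∧ S (starBlk M TT b ![true, t]))
    ∨ (k₁ ≠ 0)

/-- decidability. [folklore] -/
instance decAwin [DecidablePred S] (b : Tor M) (k₀ k₁ : ℕ) : DecidablePred (Awin M S b k₀ k₁) := fun s => by
  unfold Awin; infer_instance

/-- decidability. [folklore] -/
instance decBwin [DecidablePred S] (b : Tor M) (k₀ k₁ : ℕ) : DecidablePred (Bwin M S b k₀ k₁) := fun t => by
  unfold Bwin; infer_instance

variable {b : Tor M}

/-- membership of a chart site of the identity-oriented star in `Ω`, as a function of the two signs. [folklore] -/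
theorem blockReg_emb_TT_iff {i j : ℤ} (hi : -(n : ℤ) ≤ i) (hi' : i < n) (hj : -(n : ℤ) ≤ j) (hj' : j < n) :
    blockReg n M S (emb n M TT b i j) ↔ S (starBlk M TT b ![decide (0 ≤ i), decide (0 ≤ j)]) := by
  rw [blockReg_emb_iff n M hi hi' hj hj', sgnPat_eq_vec]

/-- **`hW` FOR THE CORNER WINDOW OF A PRODUCT STAR** (`k = (0,0)`, `τ = 0`, `K ≤ n`; `IsProdAt` of `DirichletVertexLocate`). [folklore] -/
theorem hW_corner (hprod : IsProdAt M S b) {K : ℕ} (hKn : K ≤ n) :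
    ∀ i j : ℤ, tIdx i ≤ K → tIdx j ≤ K →
      (blockReg n M S (emb n M TT b (i + 0) (j + 0)) ↔ WprodT (Awin M S b 0 0) (Bwin M S b 0 0) 0 0 i j) := by
  intro i j hi hj
  have hi' : -(n : ℤ) ≤ i ∧ i < n := by unfold tIdx at hi; split_ifs at hi <;> constructor <;> omega
  have hj' : -(n : ℤ) ≤ j ∧ j < n := by unfold tIdx at hj; split_ifs at hj <;> constructor <;> omega
  rw [add_zero, add_zero, blockReg_emb_TT_iff n M hi'.1 hi'.2 hj'.1 hj'.2]
  have hp := hprod ![decide (0 ≤ i), decide (0 ≤ j)]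
  simp only [Arow, Bcol, Matrix.cons_val_zero, Matrix.cons_val_one] at hp
  rw [hp]
  simp [WprodT, Awin, Bwin]

/-- **`hW` FOR A WINDOW ONE-SIDED IN BOTH COORDINATES** (`K ≤ τ_ν`, `τ_ν + K ≤ n`, any `k₀, k₁ ≠ 0`). [folklore] -/
theorem hW_both {k₀ k₁ : ℕ} (hk₀ : k₀ ≠ 0) (hk₁ : k₁ ≠ 0) {K : ℕ} {τ₀ τ₁ : ℤ} (h₀ : (K : ℤ) ≤ τ₀) (h₀' : τ₀ + K ≤ n)
    (h₁ : (K : ℤ) ≤ τ₁) (h₁' : τ₁ + K ≤ n) :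
    ∀ i j : ℤ, tIdx i ≤ K → tIdx j ≤ K →
      (blockReg n M S (emb n M TT b (i + τ₀) (j + τ₁)) ↔ WprodT (Awin M S b k₀ k₁) (Bwin M S b k₀ k₁) τ₀ τ₁ i j) := by
  intro i j hi hj
  have hi' : 0 ≤ i + τ₀ ∧ i + τ₀ < n := by unfold tIdx at hi; split_ifs at hi <;> constructor <;> omega
  have hj' : 0 ≤ j + τ₁ ∧ j + τ₁ < n := by unfold tIdx at hj; split_ifs at hj <;> constructor <;> omega
  rw [blockReg_emb_TT_iff n M (by omega) hi'.2 (by omega) hj'.2]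
  simp [WprodT, Awin, Bwin, hk₀, hk₁, hi'.1, hj'.1]

/-- **`hW` FOR A WINDOW TWO-SIDED IN THE FIRST COORDINATE, ONE-SIDED IN THE SECOND** (`τ₀ = 0`, `K ≤ n`, `K ≤ τ₁`, `τ₁ + K ≤ n`). [folklore] -/
theorem hW_fst {k₁ : ℕ} (hk₁ : k₁ ≠ 0) {K : ℕ} (hKn : K ≤ n) {τ₁ : ℤ} (h₁ : (K : ℤ) ≤ τ₁) (h₁' : τ₁ + K ≤ n) :
    ∀ i j : ℤ, tIdx i ≤ K → tIdx j ≤ K →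
      (blockReg n M S (emb n M TT b (i + 0) (j + τ₁)) ↔ WprodT (Awin M S b 0 k₁) (Bwin M S b 0 k₁) 0 τ₁ i j) := by
  intro i j hi hj
  have hi' : -(n : ℤ) ≤ i ∧ i < n := by unfold tIdx at hi; split_ifs at hi <;> constructor <;> omega
  have hj' : 0 ≤ j + τ₁ ∧ j + τ₁ < n := by unfold tIdx at hj; split_ifs at hj <;> constructor <;> omega
  rw [add_zero, blockReg_emb_TT_iff n M hi'.1 hi'.2 (by omega) hj'.2]
  simp [WprodT, Awin, Bwin, hk₁, hj'.1]

/-- **`hW` FOR A WINDOW ONE-SIDED IN THE FIRST COORDINATE, TWO-SIDED IN THE SECOND** (`τ₁ = 0`). [folklore] -/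
theorem hW_snd {k₀ : ℕ} (hk₀ : k₀ ≠ 0) {K : ℕ} (hKn : K ≤ n) {τ₀ : ℤ} (h₀ : (K : ℤ) ≤ τ₀) (h₀' : τ₀ + K ≤ n) :
    ∀ i j : ℤ, tIdx i ≤ K → tIdx j ≤ K →
      (blockReg n M S (emb n M TT b (i + τ₀) (j + 0)) ↔ WprodT (Awin M S b k₀ 0) (Bwin M S b k₀ 0) τ₀ 0 i j) := by
  intro i j hi hj
  have hi' : 0 ≤ i + τ₀ ∧ i + τ₀ < n := by unfold tIdx at hi; split_ifs at hi <;> constructor <;> omega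
  have hj' : -(n : ℤ) ≤ j ∧ j < n := by unfold tIdx at hj; split_ifs at hj <;> constructor <;> omega
  rw [add_zero, blockReg_emb_TT_iff n M (by omega) hi'.2 hj'.1 hj'.2]
  simp [WprodT, Awin, Bwin, hk₀, hi'.1]

end Census

end Summit.QuantumFields.BalabanUV.Beta.GAN24.DirichletVertexLocalW

end
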